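import Summits.HubbardSuperconductivity.HubbardSuperconductivity.Theorems.AnisotropyChordTransferFibre3Hole2FinRange
import Summits.HubbardSuperconductivity.HubbardSuperconductivity.Theorems.AnisotropyChordTransferFibre3Hole2L33
import Summits.HubbardSuperconductivity.HubbardSuperconductivity.Theorems.AnisotropyChordTransferFibre3Hole2L34
import Summits.HubbardSuperconductivity.HubbardSuperconductivity.Theorems.AnisotropyChordTransferFibre3Hole2L35
import Summits.HubbardSuperconductivity.HubbardSuperconductivity.Theorems.AnisotropyChordTransferFibre3Hole2L36

/-!
# Route `AnisotropyChord` / H0 rotor rung: HOLE₂(.75) for every `9 ≤ L ≤ 36`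

Extension of the capstone `…Hole2FinRange.twoHoleGap_finRange` (`9 ≤ L ≤ 32`) by the first side lengths of the analytic regime,
`L = 33, 34, 35, 36` (`…Hole2L33` … `…Hole2L36`, quarter-table kernel certificates, zero data): `twoHoleGap_range36`.
Prover seat `hubbard-h0-rotor-p3` g3; helper for stmt-HubbardSuperconductivity-19089 (`--supports`, helper class).
WHAT THIS IS NOT: nothing here proves superconductivity in the Hubbard model (rotor TARGET as worded stays FALSE, g15 verdict); one
hypothesis (HOLE₂(.75)) of ONE conditional reduction (rung 19089) on a finite range of `L`. Tree imports only; no sorry, no axioms.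
-/

set_option linter.dupNamespace false
set_option autoImplicit false

namespace Summit.HubbardSuperconductivity.HubbardSuperconductivity.Theorems.AnisotropyChord.Transfer.Fibre3

namespace Hole2

/-- ★★★ HOLE₂(.75) for every `9 ≤ L ≤ 36`: `TwoHoleGap L (3/4 * eps1 L)`. [folklore] -/
theorem twoHoleGap_range36 (L : ℕ) [NeZero L] (h9 : 9 ≤ L) (h36 : L ≤ 36) : TwoHoleGap L (3 / 4 * eps1 L) := by
  by_cases h32 : L ≤ 32
  · exact twoHoleGap_finRange L h9 h32
  · have h33 : 33 ≤ L := by omega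
    interval_cases L
    · exact twoHoleGap_thirtyThree
    · exact twoHoleGap_thirtyFour
    · exact twoHoleGap_thirtyFive
    · exact twoHoleGap_thirtySix

end Hole2

end Summit.HubbardSuperconductivity.HubbardSuperconductivity.Theorems.AnisotropyChord.Transfer.Fibre3
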